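import Mathlib
import Summits.Ventures.PercRepro2.Defs
import Summits.Ventures.PercRepro2.Independence
import Summits.Ventures.PercRepro2.Harris
import Summits.Ventures.PercRepro2.Graph
import Summits.Ventures.PercRepro2.Events
import Summits.Ventures.PercRepro2.BHKEvents
import Summits.Ventures.PercRepro2.ZCPendantSecondOrder
import Summits.Ventures.PercRepro2.CDRequired

/-!
# Row 2′CD from a MONOTONE MIXTURE of two pinned worlds (blind cell PercRepro2, mine-a g34;
MINE-A.md §89.7, proofs/MINEA-CD-NESTED.md §3)

The nested-routes theorem says: when the `a₁–a₃` paths avoiding `a₂` are nested, the `a₃`-required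
world `Q ∩ {a₃ ∈ C₁}` is a mixture of the pinned `Q`-worlds of the routes, and the mixture is MONOTONE —
the bigger route has the larger `U`-propensity and the smaller `f`-propensity.  This file proves the
abstract step: for two admissible weight vectors `p₁, p₂` (the pinned worlds) and weights `ν₁, ν₂ ≥ 0`,
if the four `a₃`-required masses of `p` decompose as
`P(QUef) = ν₁P₁(QUf) + ν₂P₂(QUf)`, `P(QUe) = ν₁P₁(QU) + ν₂P₂(QU)`, `P(Qef) = ν₁P₁(Qf) + ν₂P₂(Qf)`,
`P(Qe) = ν₁P₁(Q) + ν₂P₂(Q)`, and the propensities are ordered,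
`P₁(QU)·P₂(Q) ≤ P₂(QU)·P₁(Q)` (`β₁ ≤ β₂`) and `P₂(Qf)·P₁(Q) ≤ P₁(Qf)·P₂(Q)` (`γ₂ ≤ γ₁`),
then the `a₃`-required anti-correlation `P(QUef)·P(Qe) ≤ P(QUe)·P(Qef)` holds (`ac_of_two_worlds`),
hence row 2′CD (`cd_of_two_worlds`).  Proof: BHK06 Thm 1.4 in each world
(`A_iD_i ≤ B_iC_i`) and, for the cross term, the identity
`D₁D₂(B₁C₂ + B₂C₁) − D₂²B₁C₁ − D₁²B₂C₂ = (B₂D₁ − B₁D₂)(C₁D₂ − C₂D₁) ≥ 0`.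
The instances (the single-edge route against a longer route through `o`: `K₄`, the diamond, the paw)
supply the decomposition and the two monotonicities (avoid_mono along the longer route and its BHK-1.3
mirror).  No definition; one seat.
-/

namespace Summit.Ventures.PercRepro2

namespace CDNested

section Algebra

variable {R : Type*} [Field R] [LinearOrder R] [IsStrictOrderedRing R]

/-- **The cross term of a monotone two-world mixture.** If `A_iD_i ≤ B_iC_i` (BHK in each world),
`A_i ≤ D_i`, `B_i ≤ D_i`, `C_i ≤ D_i` (masses), all nonnegative, `B₁D₂ ≤ B₂D₁` and `C₂D₁ ≤ C₁D₂`
(ordered propensities), then `A₁D₂ + A₂D₁ ≤ B₁C₂ + B₂C₁`. -/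
lemma cross_le {A₁ B₁ C₁ D₁ A₂ B₂ C₂ D₂ : R} (hA₁ : 0 ≤ A₁) (hA₂ : 0 ≤ A₂) (hB₁ : 0 ≤ B₁)
    (hB₂ : 0 ≤ B₂) (hC₁ : 0 ≤ C₁) (hC₂ : 0 ≤ C₂) (hD₁ : 0 ≤ D₁) (hD₂ : 0 ≤ D₂)
    (hAD₁ : A₁ ≤ D₁) (hAD₂ : A₂ ≤ D₂) (hBD₁ : B₁ ≤ D₁) (hBD₂ : B₂ ≤ D₂) (hCD₁ : C₁ ≤ D₁)
    (hCD₂ : C₂ ≤ D₂) (h1 : A₁ * D₁ ≤ B₁ * C₁) (h2 : A₂ * D₂ ≤ B₂ * C₂)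
    (hβ : B₁ * D₂ ≤ B₂ * D₁) (hγ : C₂ * D₁ ≤ C₁ * D₂) :
    A₁ * D₂ + A₂ * D₁ ≤ B₁ * C₂ + B₂ * C₁ := by
  rcases hD₁.lt_or_eq with hD₁p | hD₁z
  · rcases hD₂.lt_or_eq with hD₂p | hD₂z
    · -- multiply the claim by `D₁ D₂ > 0`
      have hpos : 0 < D₁ * D₂ := mul_pos hD₁p hD₂p
      refine le_of_mul_le_mul_left ?_ hpos
      have e1 : D₁ * D₂ * (A₁ * D₂) = D₂ * D₂ * (A₁ * D₁) := by ring
      have e2 : D₁ * D₂ * (A₂ * D₁) = D₁ * D₁ * (A₂ * D₂) := by ring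
      have t1 : D₂ * D₂ * (A₁ * D₁) ≤ D₂ * D₂ * (B₁ * C₁) :=
        mul_le_mul_of_nonneg_left h1 (mul_nonneg hD₂ hD₂)
      have t2 : D₁ * D₁ * (A₂ * D₂) ≤ D₁ * D₁ * (B₂ * C₂) :=
        mul_le_mul_of_nonneg_left h2 (mul_nonneg hD₁ hD₁)
      have key : 0 ≤ (B₂ * D₁ - B₁ * D₂) * (C₁ * D₂ - C₂ * D₁) :=
        mul_nonneg (by linarith) (by linarith)
      nlinarith [e1, e2, t1, t2, key]
    · -- `D₂ = 0`: then `A₂ = B₂ = C₂ = 0`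
      subst hD₂z
      have hA₂' : A₂ = 0 := le_antisymm (by linarith) hA₂
      have hB₂' : B₂ = 0 := le_antisymm (by linarith) hB₂
      have hC₂' : C₂ = 0 := le_antisymm (by linarith) hC₂
      subst hA₂' hB₂' hC₂'
      simp
  · -- `D₁ = 0`: then `A₁ = B₁ = C₁ = 0`
    subst hD₁z
    have hA₁' : A₁ = 0 := le_antisymm (by linarith) hA₁
    have hB₁' : B₁ = 0 := le_antisymm (by linarith) hB₁
    have hC₁' : C₁ = 0 := le_antisymm (by linarith) hC₁
    subst hA₁' hB₁' hC₁'
    simp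

/-- **The mixture inequality**: with the cross term, the mixed masses satisfy the anti-correlation. -/
lemma mixture_le {A₁ B₁ C₁ D₁ A₂ B₂ C₂ D₂ ν₁ ν₂ : R} (hν₁ : 0 ≤ ν₁) (hν₂ : 0 ≤ ν₂)
    (h1 : A₁ * D₁ ≤ B₁ * C₁) (h2 : A₂ * D₂ ≤ B₂ * C₂)
    (hx : A₁ * D₂ + A₂ * D₁ ≤ B₁ * C₂ + B₂ * C₁) :
    (ν₁ * A₁ + ν₂ * A₂) * (ν₁ * D₁ + ν₂ * D₂) ≤ (ν₁ * B₁ + ν₂ * B₂) * (ν₁ * C₁ + ν₂ * C₂) := by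
  have e : (ν₁ * B₁ + ν₂ * B₂) * (ν₁ * C₁ + ν₂ * C₂) - (ν₁ * A₁ + ν₂ * A₂) * (ν₁ * D₁ + ν₂ * D₂) =
      ν₁ * ν₁ * (B₁ * C₁ - A₁ * D₁) + ν₂ * ν₂ * (B₂ * C₂ - A₂ * D₂) +
        ν₁ * ν₂ * ((B₁ * C₂ + B₂ * C₁) - (A₁ * D₂ + A₂ * D₁)) := by ring
  have t1 : 0 ≤ ν₁ * ν₁ * (B₁ * C₁ - A₁ * D₁) := mul_nonneg (mul_nonneg hν₁ hν₁) (by linarith)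
  have t2 : 0 ≤ ν₂ * ν₂ * (B₂ * C₂ - A₂ * D₂) := mul_nonneg (mul_nonneg hν₂ hν₂) (by linarith)
  have t3 : 0 ≤ ν₁ * ν₂ * ((B₁ * C₂ + B₂ * C₁) - (A₁ * D₂ + A₂ * D₁)) :=
    mul_nonneg (mul_nonneg hν₁ hν₂) (by linarith)
  linarith [e, t1, t2, t3]

end Algebra

section Main

variable {V : Type*} {E : Type*} [Fintype E] [DecidableEq E] [Fintype V] [DecidableEq V]
  {R : Type*} [Field R] [LinearOrder R] [IsStrictOrderedRing R]

/-- **BHK06 Thm 1.4 in the form of the mixture lemma**: `P(QUf)·P(Q) ≤ P(QU)·P(Qf)`. -/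
lemma bhk_world (p : E → R) (hp : IsProbVec p) (ends : E → Sym2 V) (a₁ a₂ o : V)
    {𝓔 : Set (Set V)} (h𝓔 : IsUpperSet 𝓔) :
    prob p ((connEvent ends a₁ a₂)ᶜ ∩ clusterInEvent ends a₁ 𝓔 ∩ connEvent ends a₂ o) *
        prob p (connEvent ends a₁ a₂)ᶜ ≤
      prob p ((connEvent ends a₁ a₂)ᶜ ∩ clusterInEvent ends a₁ 𝓔) *
        prob p ((connEvent ends a₁ a₂)ᶜ ∩ connEvent ends a₂ o) := by
  have key := bhk_cross_cluster p hp ends a₁ a₂ h𝓔 (ZCPendant.isUpperSet_mem_o (V := V) o)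
  rw [ZCPendant.clusterInEvent_mem_o_eq] at key
  have e1 : clusterInEvent ends a₁ 𝓔 ∩ connEvent ends a₂ o ∩ (connEvent ends a₁ a₂)ᶜ =
      (connEvent ends a₁ a₂)ᶜ ∩ clusterInEvent ends a₁ 𝓔 ∩ connEvent ends a₂ o := by
    ext ω; simp only [Set.mem_inter_iff]; tauto
  have e3 : clusterInEvent ends a₁ 𝓔 ∩ (connEvent ends a₁ a₂)ᶜ =
      (connEvent ends a₁ a₂)ᶜ ∩ clusterInEvent ends a₁ 𝓔 := Set.inter_comm _ _
  have e4 : connEvent ends a₂ o ∩ (connEvent ends a₁ a₂)ᶜ =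
      (connEvent ends a₁ a₂)ᶜ ∩ connEvent ends a₂ o := Set.inter_comm _ _
  rw [e1, e3, e4] at key
  exact key

/-- **The `a₃`-required anti-correlation from a monotone two-world mixture.** -/
theorem ac_of_two_worlds (p p₁ p₂ : E → R) (hp₁ : IsProbVec p₁) (hp₂ : IsProbVec p₂)
    (ends : E → Sym2 V) (a₁ a₂ a₃ o : V) {𝓔 : Set (Set V)} (h𝓔 : IsUpperSet 𝓔) {ν₁ ν₂ : R}
    (hν₁ : 0 ≤ ν₁) (hν₂ : 0 ≤ ν₂)
    (hA : prob p ((connEvent ends a₁ a₂)ᶜ ∩ clusterInEvent ends a₁ 𝓔 ∩ connEvent ends a₁ a₃ ∩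
        connEvent ends a₂ o) =
      ν₁ * prob p₁ ((connEvent ends a₁ a₂)ᶜ ∩ clusterInEvent ends a₁ 𝓔 ∩ connEvent ends a₂ o) +
      ν₂ * prob p₂ ((connEvent ends a₁ a₂)ᶜ ∩ clusterInEvent ends a₁ 𝓔 ∩ connEvent ends a₂ o))
    (hB : prob p ((connEvent ends a₁ a₂)ᶜ ∩ clusterInEvent ends a₁ 𝓔 ∩ connEvent ends a₁ a₃) =
      ν₁ * prob p₁ ((connEvent ends a₁ a₂)ᶜ ∩ clusterInEvent ends a₁ 𝓔) +
      ν₂ * prob p₂ ((connEvent ends a₁ a₂)ᶜ ∩ clusterInEvent ends a₁ 𝓔))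
    (hC : prob p ((connEvent ends a₁ a₂)ᶜ ∩ connEvent ends a₁ a₃ ∩ connEvent ends a₂ o) =
      ν₁ * prob p₁ ((connEvent ends a₁ a₂)ᶜ ∩ connEvent ends a₂ o) +
      ν₂ * prob p₂ ((connEvent ends a₁ a₂)ᶜ ∩ connEvent ends a₂ o))
    (hD : prob p ((connEvent ends a₁ a₂)ᶜ ∩ connEvent ends a₁ a₃) =
      ν₁ * prob p₁ (connEvent ends a₁ a₂)ᶜ + ν₂ * prob p₂ (connEvent ends a₁ a₂)ᶜ)
    (hβ : prob p₁ ((connEvent ends a₁ a₂)ᶜ ∩ clusterInEvent ends a₁ 𝓔) *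
        prob p₂ (connEvent ends a₁ a₂)ᶜ ≤
      prob p₂ ((connEvent ends a₁ a₂)ᶜ ∩ clusterInEvent ends a₁ 𝓔) *
        prob p₁ (connEvent ends a₁ a₂)ᶜ)
    (hγ : prob p₂ ((connEvent ends a₁ a₂)ᶜ ∩ connEvent ends a₂ o) *
        prob p₁ (connEvent ends a₁ a₂)ᶜ ≤
      prob p₁ ((connEvent ends a₁ a₂)ᶜ ∩ connEvent ends a₂ o) *
        prob p₂ (connEvent ends a₁ a₂)ᶜ) :
    prob p ((connEvent ends a₁ a₂)ᶜ ∩ clusterInEvent ends a₁ 𝓔 ∩ connEvent ends a₁ a₃ ∩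
          connEvent ends a₂ o) * prob p ((connEvent ends a₁ a₂)ᶜ ∩ connEvent ends a₁ a₃) ≤
      prob p ((connEvent ends a₁ a₂)ᶜ ∩ clusterInEvent ends a₁ 𝓔 ∩ connEvent ends a₁ a₃) *
        prob p ((connEvent ends a₁ a₂)ᶜ ∩ connEvent ends a₁ a₃ ∩ connEvent ends a₂ o) := by
  rw [hA, hB, hC, hD]
  set Q := (connEvent ends a₁ a₂)ᶜ
  set U := clusterInEvent ends a₁ 𝓔
  set f := connEvent ends a₂ o
  have h1 := bhk_world p₁ hp₁ ends a₁ a₂ o h𝓔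
  have h2 := bhk_world p₂ hp₂ ends a₁ a₂ o h𝓔
  have hx := cross_le (prob_nonneg hp₁ _) (prob_nonneg hp₂ _) (prob_nonneg hp₁ _) (prob_nonneg hp₂ _)
    (prob_nonneg hp₁ _) (prob_nonneg hp₂ _) (prob_nonneg hp₁ _) (prob_nonneg hp₂ _)
    (prob_mono hp₁ (Set.inter_subset_left.trans Set.inter_subset_left))
    (prob_mono hp₂ (Set.inter_subset_left.trans Set.inter_subset_left))
    (prob_mono hp₁ Set.inter_subset_left) (prob_mono hp₂ Set.inter_subset_left)
    (prob_mono hp₁ Set.inter_subset_left) (prob_mono hp₂ Set.inter_subset_left) h1 h2 hβ hγ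
  exact mixture_le hν₁ hν₂ h1 h2 hx

/-- **Row 2′CD from a monotone two-world mixture** (the hypotheses of `ac_of_two_worlds`). -/
theorem cd_of_two_worlds (p p₁ p₂ : E → R) (hp : IsProbVec p) (hp₁ : IsProbVec p₁)
    (hp₂ : IsProbVec p₂) (ends : E → Sym2 V) (a₁ a₂ a₃ o : V) {𝓔 : Set (Set V)}
    (h𝓔 : IsUpperSet 𝓔) {ν₁ ν₂ : R} (hν₁ : 0 ≤ ν₁) (hν₂ : 0 ≤ ν₂)
    (hA : prob p ((connEvent ends a₁ a₂)ᶜ ∩ clusterInEvent ends a₁ 𝓔 ∩ connEvent ends a₁ a₃ ∩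
        connEvent ends a₂ o) =
      ν₁ * prob p₁ ((connEvent ends a₁ a₂)ᶜ ∩ clusterInEvent ends a₁ 𝓔 ∩ connEvent ends a₂ o) +
      ν₂ * prob p₂ ((connEvent ends a₁ a₂)ᶜ ∩ clusterInEvent ends a₁ 𝓔 ∩ connEvent ends a₂ o))
    (hB : prob p ((connEvent ends a₁ a₂)ᶜ ∩ clusterInEvent ends a₁ 𝓔 ∩ connEvent ends a₁ a₃) =
      ν₁ * prob p₁ ((connEvent ends a₁ a₂)ᶜ ∩ clusterInEvent ends a₁ 𝓔) +
      ν₂ * prob p₂ ((connEvent ends a₁ a₂)ᶜ ∩ clusterInEvent ends a₁ 𝓔))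
    (hC : prob p ((connEvent ends a₁ a₂)ᶜ ∩ connEvent ends a₁ a₃ ∩ connEvent ends a₂ o) =
      ν₁ * prob p₁ ((connEvent ends a₁ a₂)ᶜ ∩ connEvent ends a₂ o) +
      ν₂ * prob p₂ ((connEvent ends a₁ a₂)ᶜ ∩ connEvent ends a₂ o))
    (hD : prob p ((connEvent ends a₁ a₂)ᶜ ∩ connEvent ends a₁ a₃) =
      ν₁ * prob p₁ (connEvent ends a₁ a₂)ᶜ + ν₂ * prob p₂ (connEvent ends a₁ a₂)ᶜ)
    (hβ : prob p₁ ((connEvent ends a₁ a₂)ᶜ ∩ clusterInEvent ends a₁ 𝓔) *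
        prob p₂ (connEvent ends a₁ a₂)ᶜ ≤
      prob p₂ ((connEvent ends a₁ a₂)ᶜ ∩ clusterInEvent ends a₁ 𝓔) *
        prob p₁ (connEvent ends a₁ a₂)ᶜ)
    (hγ : prob p₂ ((connEvent ends a₁ a₂)ᶜ ∩ connEvent ends a₂ o) *
        prob p₁ (connEvent ends a₁ a₂)ᶜ ≤
      prob p₁ ((connEvent ends a₁ a₂)ᶜ ∩ connEvent ends a₂ o) *
        prob p₂ (connEvent ends a₁ a₂)ᶜ) :
    let Q := (connEvent ends a₁ a₂)ᶜ
    let U := clusterInEvent ends a₁ 𝓔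
    let e := connEvent ends a₁ a₃
    let f := connEvent ends a₂ o
    let N := (connEvent ends a₁ a₃)ᶜ ∩ (connEvent ends a₂ a₃)ᶜ
    let oU := connEvent ends a₁ o ∪ connEvent ends a₂ o
    prob p (Q ∩ N) * (prob p Q * prob p (Q ∩ U ∩ e ∩ f) - prob p (Q ∩ U) * prob p (Q ∩ e ∩ f)) ≤
      prob p (Q ∩ N ∩ oU) * (prob p Q * prob p (Q ∩ U ∩ e) - prob p (Q ∩ U) * prob p (Q ∩ e)) :=
  CDRequired.cd_of_required_anticorr p hp ends a₁ a₂ a₃ o h𝓔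
    (ac_of_two_worlds p p₁ p₂ hp₁ hp₂ ends a₁ a₂ a₃ o h𝓔 hν₁ hν₂ hA hB hC hD hβ hγ)

end Main

end CDNested

end Summit.Ventures.PercRepro2
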